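import Summits.HodgeConjecture.CorCM.GaloisOddMetacyclicCertificates
import HarnessLib

/-!
# `Gal(K/ℚ) ≅ C₁₁ ⋊ C₈` is BAD: a simple DEGENERATE CM abelian `44`-fold (kernel certificate)

COR-CM (cell `pub-hodgecm2`), binder seat b04 (gen 26), count-neutral claim CYCLIC-SEMIDIRECT-RESIDUE, part VII♯c — `C₁₁ ⋊ C₈`
(order `88`, inversion action, `a = 1`, `p = 11 ≡ 3 (mod 8)`: `4 ∣ p + 1`, so `±i` is a norm from `ℚ(ζ₄₄)` to `ℚ(i, ζ₁₁ + ζ₁₁⁻¹)`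
and the GOOD mechanism of `CorCM/GaloisCyclicSemidirectEight*` fails).  The seat census (two-sheet, exhaustive over the
`4¹¹ × 4¹¹` interval types; gen 25 compute j190567 and gen 26 j199909) finds `2 400 656` degenerate sheet pairs, almost all
primitive; the kernel lattices of these types are of two kinds — «arithmetic» ones (LLL-reduced basis with entries `≈ 89`, no
balanced set) and «combinatorial» ones (basis with entries in `{0, ±1}`); ONE of the latter, with a balanced set of size `12`
(LLL, python-flint), is recorded here and checked by `decide` through `GaloisOddMetacyclic.exists_simple_degenerate_of_
inversion_balanced`, under the SAME hypothesis `e : Gal(K/ℚ) ≃* Multiplicative (ZMod 11) ⋊[φ] Multiplicative (ZMod 8)` (`φ(1)` =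
inversion) as the GOOD theorems.  KERNEL ONLY: theorems; no definition, no named fact, no `sorry`.  `HC_CM` is neither used nor
claimed.

THE CERTIFICATE (coordinates `(v, s) ↔ u^v y^s ∈ ℤ/11 × ℤ/8`, law `(v₁,s₁)(v₂,s₂) = (v₁ + 10^{s₁} v₂, s₁+s₂)`, `c₀ = (0,4)`): the
CM set `T₀` is the two-sheet type with interval fibres `t = (1,2,1,1,0,1,3,0,2,3,2)`, `t' = (2,1,2,1,0,2,1,1,0,1,3)` (B-rank
`45 − 20`); `D = {(0,0), (0,5), (1,1), (1,2), (3,2), (3,4), (4,3), (5,4), (5,6), (5,7), (7,6), (8,0)}`.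

* **`exists_simple_degenerate_cyclic11_semidirect_8`** — a simple degenerate abelian variety of dimension `44` with CM by `K`
  and a rational `(q,q)` class outside the divisor ring on some power: `C₁₁ ⋊ C₈` is BAD (like `C₃ ⋊ C₈`, `C₇ ⋊ C₈`; whereas
  `C₅ ⋊ C₈`, `C₁₃ ⋊ C₈` are GOOD).

## References

* [Shimura1998] G. Shimura, *Abelian Varieties with Complex Multiplication and Modular Functions*, §6.2 Thm. 3, §8.2 Prop. 26.
* [Gordon1999HodgeAVSurvey] B. B. Gordon, *A survey of the Hodge conjecture for abelian varieties*, Thm. 6.4, §9.3.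
-/

noncomputable section

open CategoryTheory CategoryTheory.Limits NumberField
open scoped BigOperators

namespace Summit.HodgeConjecture.CorCM.GaloisOddMetacyclic

open Literature.NumberTheory.ComplexMultiplication
open Literature.AlgebraicGeometry.Motives (AbelianVariety CMType)
open Literature.AlgebraicGeometry.HodgeTheory
open Literature.AlgebraicGeometry.ComplexMultiplication (IsCMTypeRealisation)
open Literature.AlgebraicGeometry.Pohlmann1968
open Literature.Barriers.HodgeConjecture (divisorClassesSpan)

variable {K : Type} [Field K] [NumberField K] [IsCMField K] [IsGalois ℚ K]

set_option maxRecDepth 16000 in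
/-- **`Gal(K/ℚ) ≅ C₁₁ ⋊ C₈` (`φ(1)` = inversion): a simple DEGENERATE abelian `44`-fold with CM by `K`**, with a rational
`(q,q)` class outside the divisor ring on some power — by the balanced-set certificate `(T₀, D)` above, checked by `decide`.
[cite: Shimura1998, §6.2 Thm. 3 and §8.2 Prop. 26] [cite: Gordon1999HodgeAVSurvey, Thm. 6.4 and §9.3] -/
theorem exists_simple_degenerate_cyclic11_semidirect_8
    (φ : Multiplicative (ZMod (2 ^ (1 + 2))) →* MulAut (Multiplicative (ZMod 11)))
    (hφ : ∀ v : Multiplicative (ZMod 11), φ (Multiplicative.ofAdd 1) v = v⁻¹)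
    (e : (K ≃ₐ[ℚ] K) ≃* Multiplicative (ZMod 11) ⋊[φ] Multiplicative (ZMod (2 ^ (1 + 2)))) :
    ∃ (Φ : CMType K) (φ₀ : K →+* ℂ) (A : AbelianVariety ℂ) (ι : 𝓞 K →+* End A)
      (θ : K →+* Module.End ℂ (complexBetti A.X 1)),
      IsPrimitive (ℂ ≃+* ℂ) Φ.1 φ₀ ∧ ¬ IsNondegenerate Φ ∧ IsCMTypeRealisation Φ A ι θ ∧ A.IsSimple ∧ A.dim = 44 ∧
      ∃ n q : ℕ, ∃ x : complexBetti (⨁ fun _ : Fin n => A).X (2 * q), IsRationalClass x ∧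
        IsOfHodgeType (⨁ fun _ : Fin n => A).dim (⨁ fun _ : Fin n => A).X (2 * q) q q x ∧
        x ∉ divisorClassesSpan (⨁ fun _ : Fin n => A).X (⨁ fun _ : Fin n => A).dim q := by
  obtain ⟨Φ, φ₀, A, ι, θ, h1, h2, h3, h4, h5, h6⟩ :=
    exists_simple_degenerate_of_inversion_balanced (a := 1) (K := K) (by norm_num) (by norm_num) φ hφ e
      {(0, 2), (0, 4), (0, 5), (0, 7), (1, 3), (1, 4), (1, 5), (1, 6), (2, 2), (2, 4), (2, 5), (2, 7), (3, 2), (3, 3), (3, 4),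
        (3, 5), (4, 0), (4, 1), (4, 2), (4, 3), (5, 2), (5, 4), (5, 5), (5, 7), (6, 0), (6, 3), (6, 5), (6, 6), (7, 0), (7, 2),
        (7, 3), (7, 5), (8, 1), (8, 3), (8, 4), (8, 6), (9, 0), (9, 3), (9, 5), (9, 6), (10, 1), (10, 4), (10, 6), (10, 7)}
      (by decide) (by decide)
      {(0, 0), (0, 5), (1, 1), (1, 2), (3, 2), (3, 4), (4, 3), (5, 4), (5, 6), (5, 7), (7, 6), (8, 0)} (by decide) (by decide)
  exact ⟨Φ, φ₀, A, ι, θ, h1, h2, h3, h4, by norm_num at h5; exact h5, h6⟩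

end Summit.HodgeConjecture.CorCM.GaloisOddMetacyclic

end
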